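import Summits.RiemannHypothesis.RiemannHypothesis.Theorems.CCRouteAdapters
import Literature.NumberTheory.ConnesConsani2021.ArchDensityOfMajorant
import Literature.NumberTheory.LFunctions.ProlateEigenvalueDecay
import HarnessLib

/-!
# Route «ConnesConsaniSemilocal», crux K0 `DensityRegular` (stmt-RiemannHypothesis-19307) — CONDITIONAL closer

RH-FREE bookkeeping of an RH-free corpus statement (cell `rh-crit/cc`, recipe of record cc-lead R71 (2) /
gm-t16 07:13–07:19Z; filed by the prover seat rh-explicit-sos-filer-1 on loan, director-rh g4 07:35Z / cc-lead R71).
K0 says: there is a `C²` function on `ℝ` that agrees on `[0, ∞)` with the archimedean density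
`ε ∘ exp` of Connes–Consani 2021 §5 (the route states the density inline; `CCRouteAdapters.densityRegular_iff`
identifies it with the corpus predicate `IsArchDensity`).  gm-t16's `ArchDensityOfMajorant` proves this modulo
exactly ONE decay input `Σ_n |λ(n)|·n² < ∞` (`exists_contDiff_isArchDensity_of_summable`), and t15's
`ProlateEigenvalueDecay` derives that input from the published eigenvalue bound of Osipov 2013, Theorem 33
(`summable_abs_prolateEigen_mul_sq_of_osipov`), typed as the named fact `Osipov2013_thm_33` (proved in print, not yet
in the tree).  Hence the theorem below is CONDITIONAL on that one named fact: a `conditional-result` for the gate;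
the item closes unconditionally the hour `Osipov2013_thm_33` is discharged.
WHAT THIS IS NOT: any claim about RH — nothing here bears on the truth of RH.
-/

-- `Summit.RiemannHypothesis.RiemannHypothesis.…` duplicates `RiemannHypothesis` BY DESIGN (D-0017).
set_option linter.dupNamespace false

namespace Summit.RiemannHypothesis.RiemannHypothesis.Theorems.CCRouteAdapters

open Literature.NumberTheory.LFunctions Literature.NumberTheory.ConnesConsani2021

/-- **K0 `DensityRegular` from Osipov 2013 Thm 33** (route «ConnesConsaniSemilocal», item stmt-RiemannHypothesis-19307),
CONDITIONAL on the named fact `Osipov2013_thm_33`: Osipov's eventual eigenvalue bound gives `Σ |λ(n)| n² < ∞`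
(`summable_abs_prolateEigen_mul_sq_of_osipov`), whence a `C²` archimedean density exists
(`exists_contDiff_isArchDensity_of_summable`), which is the route item by the K0 transport
(`densityRegular_of_isArchDensity`). -/
theorem densityRegular_of_osipov (h : Osipov2013_thm_33) :
    Summit.RiemannHypothesis.RiemannHypothesis.Theses.ConnesConsaniSemilocal.DensityRegular := by
  obtain ⟨G, hG, hGa, -⟩ :=
    exists_contDiff_isArchDensity_of_summable (summable_abs_prolateEigen_mul_sq_of_osipov h)
  exact densityRegular_of_isArchDensity hG hGa

end Summit.RiemannHypothesis.RiemannHypothesis.Theorems.CCRouteAdapters
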